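import Mathlib
import Literature.NumberTheory.DiophantineApproximation.SimultaneousApproxComplexity
import Literature.Computability.Complexity.IntegerProgrammingFixedDimension
import HarnessLib

/-!
# GOOD SIMULTANEOUS APPROXIMATION in dimension `d` is an integer program in `d + 1` variables

Topic `NumberTheory/DiophantineApproximation`; first half of the printed proof of Lagarias's
fixed-dimension theorem (`Lagarias1985_gsaOfDim_mem_P` of `SimultaneousApproxComplexity.lean`:
GSA in fixed dimension is in `P`). Lagarias 1985 (as reported by Schrijver 1986, p. 168: "He showed
moreover that, if we fix `n`, this problem is polynomially solvable") reduces GSA in dimension `d` to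
H. W. Lenstra's integer linear programming algorithm in the fixed number `d + 1` of variables
`(q, p₁, …, p_d)`: the question `∃ q ∈ [1, N], ∃ p ∈ ℤ^d, |q αᵢ - pᵢ| ≤ ε` IS the feasibility of the
integral system

  `-q ≤ -1`, `q ≤ N`, `s₂ aᵢ q - s₂ b pᵢ ≤ s₁ b`, `-s₂ aᵢ q + s₂ b pᵢ ≤ s₁ b` (`i < d`),

where `αᵢ = aᵢ / b` and `ε = s₁ / s₂` in lowest terms. This file defines that instance map
`SimultaneousApproxInstance.toILP : SimultaneousApproxInstance → ILPInstance` (vocabulary of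
`Literature.Computability.Complexity.IntegerProgrammingFixedDimension`) and proves

* `feasible_toILP_iff : I.toILP.Feasible ↔ I.Yes` (with the tree's junk convention `b = 0 ↦ αᵢ = 0`,
  realised by normalising `(a, b) := (0, 1)` first: `num'`, `den'`);
* `numVars_toILP : I.toILP.numVars = I.dim + 1`;
* `isBounded_toILP : I.toILP.IsBounded` — the polyhedron is a polytope (inside the box
  `1 ≤ q ≤ N`, `|pᵢ| ≤ (|s₁| b + s₂ |aᵢ| N) / (s₂ b)`), which is the case of Lenstra's algorithm the
  sibling files formalize.

The polynomial-time computability of `toILP` on codes and the assembly of `gsaLangOfDim d ∈ P` from a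
fixed-dimension ILP decider are in `SimultaneousApproxComplexityILPMachine.lean`.

## References

* J. C. Lagarias, *The computational complexity of simultaneous Diophantine approximation problems*,
  SIAM J. Comput. 14 (1985) 196–209, fixed-dimension theorem (via [LenstraHW1983]). [Lagarias1985]
* A. Schrijver, *Theory of Linear and Integer Programming*, Wiley 1986, §6.3 p. 168 (statement),
  §18.4 Cor. 18.7a (Lenstra's algorithm). [Schrijver1986]
* H. W. Lenstra, Jr., *Integer programming with a fixed number of variables*, Math. Oper. Res. 8
  (1983) 538–548, §1. [LenstraHW1983]
-/

namespace Literature.NumberTheory.DiophantineApproximation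

open Literature.Computability.Complexity
open Literature.Computability.Complexity.ILPInstance (RowHolds)

namespace SimultaneousApproxInstance

/-! ### Normalising the junk denominator `b = 0` -/

/-- The effective denominator: `b`, or `1` when `b = 0` (then every `αᵢ = aᵢ / 0` is the junk value
`0 = 0 / 1`). [folklore] -/
def den' (I : SimultaneousApproxInstance) : ℕ := if I.den = 0 then 1 else I.den

/-- The effective numerators: `a`, or `0` when `b = 0`. [folklore] -/
def num' (I : SimultaneousApproxInstance) : Fin I.dim → ℤ := if I.den = 0 then 0 else I.num

/-- The effective denominator is positive. [folklore] -/
theorem den'_pos (I : SimultaneousApproxInstance) : 0 < I.den' := by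
  unfold den'; split_ifs with h <;> omega

/-- The normalisation does not change the rationals `q αᵢ = q aᵢ / b` (junk included). [folklore] -/
theorem mul_num_div_den_eq (I : SimultaneousApproxInstance) (q : ℚ) (i : Fin I.dim) :
    q * I.num i / I.den = q * I.num' i / I.den' := by
  unfold num' den'
  split_ifs with h
  · simp [h]
  · rfl

/-! ### The integer program -/

/-- The row `s₂ aᵢ q - s₂ b pᵢ ≤ s₁ b` (`ε = s₁/s₂`), i.e. `s₂ (q aᵢ - b pᵢ) ≤ s₁ b`, on the variables
`x : Fin (d + 1) → ℤ`, `x 0 = q`, `x i.succ = pᵢ`. [cite: Lagarias1985, fixed-dimension theorem (the ILP formulation)] -/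
def upperRow (I : SimultaneousApproxInstance) (i : Fin I.dim) : (Fin (I.dim + 1) → ℤ) × ℤ :=
  (Pi.single 0 ((I.eps.den : ℤ) * I.num' i) - Pi.single i.succ ((I.eps.den : ℤ) * I.den'),
    I.eps.num * I.den')

/-- The row `-(s₂ aᵢ q - s₂ b pᵢ) ≤ s₁ b`. [cite: Lagarias1985, fixed-dimension theorem (the ILP formulation)] -/
def lowerRow (I : SimultaneousApproxInstance) (i : Fin I.dim) : (Fin (I.dim + 1) → ℤ) × ℤ :=
  (-(I.upperRow i).1, I.eps.num * I.den')

/-- The rows of the integer program: `-q ≤ -1`, `q ≤ N`, then `upperRow i` (`i < d`), then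
`lowerRow i` (`i < d`). [cite: Lagarias1985, fixed-dimension theorem (the ILP formulation)] -/
def toILPRows (I : SimultaneousApproxInstance) : List ((Fin (I.dim + 1) → ℤ) × ℤ) :=
  (-Pi.single 0 1, -1) :: (Pi.single 0 1, (I.bound : ℤ)) :: (List.ofFn I.upperRow ++ List.ofFn I.lowerRow)

/-- **GSA as an integer program** in the `d + 1` variables `(q, p₁, …, p_d)`: rows `-q ≤ -1`, `q ≤ N`,
and for each `i` the pair `± s₂ (q aᵢ - b pᵢ) ≤ s₁ b`, where `αᵢ = aᵢ/b` (normalised by `num'`/`den'`)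
and `ε = s₁/s₂` in lowest terms. [cite: Lagarias1985, fixed-dimension theorem (reduction to [LenstraHW1983])] [cite: Schrijver1986, §6.3 p. 168 and Cor. 18.7a] -/
def toILP (I : SimultaneousApproxInstance) : ILPInstance :=
  ⟨I.dim + 1, I.toILPRows⟩

/-- The integer program has `d + 1` variables. [folklore] -/
@[simp] theorem numVars_toILP (I : SimultaneousApproxInstance) : I.toILP.numVars = I.dim + 1 := rfl

/-- The rows of the integer program. [folklore] -/
theorem toILP_eq (I : SimultaneousApproxInstance) : I.toILP = ⟨I.dim + 1, I.toILPRows⟩ := rfl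

/-- Feasibility of the integer program, on the explicit row list. [folklore] -/
theorem feasible_toILP_iff_rows (I : SimultaneousApproxInstance) :
    I.toILP.Feasible ↔ ∃ x : Fin (I.dim + 1) → ℤ, ∀ r ∈ I.toILPRows, RowHolds r x :=
  Iff.rfl

/-- The polyhedron of the integer program, on the explicit row list. [folklore] -/
theorem mem_polyhedron_toILP_iff (I : SimultaneousApproxInstance) (x : Fin (I.dim + 1) → ℝ) :
    x ∈ I.toILP.polyhedron ↔ ∀ r ∈ I.toILPRows, ∑ j, (r.1 j : ℝ) * x j ≤ r.2 :=
  Iff.rfl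

/-! ### Evaluating the rows -/

/-- `Pi.single j c · x = c x j`. [folklore] -/
theorem sum_single_mul {n : ℕ} (j : Fin n) (c : ℤ) (x : Fin n → ℤ) :
    ∑ k, (Pi.single j c : Fin n → ℤ) k * x k = c * x j := by
  simp [Pi.single_apply]

/-- The linear form of `upperRow i` at `x` is `s₂ aᵢ x₀ - s₂ b x_{i+1}`. [folklore] -/
theorem sum_upperRow_mul (I : SimultaneousApproxInstance) (i : Fin I.dim) (x : Fin (I.dim + 1) → ℤ) :
    ∑ k, (I.upperRow i).1 k * x k =
      (I.eps.den : ℤ) * I.num' i * x 0 - (I.eps.den : ℤ) * I.den' * x i.succ := by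
  simp only [upperRow, Pi.sub_apply, sub_mul, Finset.sum_sub_distrib, sum_single_mul]

/-- The linear form of `lowerRow i` at `x` is `-(s₂ aᵢ x₀ - s₂ b x_{i+1})`. [folklore] -/
theorem sum_lowerRow_mul (I : SimultaneousApproxInstance) (i : Fin I.dim) (x : Fin (I.dim + 1) → ℤ) :
    ∑ k, (I.lowerRow i).1 k * x k =
      -((I.eps.den : ℤ) * I.num' i * x 0 - (I.eps.den : ℤ) * I.den' * x i.succ) := by
  rw [← sum_upperRow_mul]
  simp only [lowerRow, Pi.neg_apply, neg_mul, Finset.sum_neg_distrib]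

/-- Feasibility of `I.toILP` by a vector `x`, unfolded: `1 ≤ x₀ ≤ N` and
`|s₂ (aᵢ x₀ - b x_{i+1})| ≤ s₁ b` for every `i`. [folklore] -/
theorem forall_rowHolds_toILP_iff (I : SimultaneousApproxInstance) (x : Fin (I.dim + 1) → ℤ) :
    (∀ r ∈ I.toILPRows, RowHolds r x) ↔
      1 ≤ x 0 ∧ x 0 ≤ I.bound ∧ ∀ i : Fin I.dim,
        |(I.eps.den : ℤ) * (I.num' i * x 0 - I.den' * x i.succ)| ≤ I.eps.num * I.den' := by
  have hsplit : (∀ r ∈ List.ofFn I.upperRow ++ List.ofFn I.lowerRow, RowHolds r x) ↔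
      (∀ i, RowHolds (I.upperRow i) x) ∧ ∀ i, RowHolds (I.lowerRow i) x := by
    simp only [List.mem_append, List.mem_ofFn]
    exact ⟨fun h => ⟨fun i => h _ (Or.inl ⟨i, rfl⟩), fun i => h _ (Or.inr ⟨i, rfl⟩)⟩,
      fun h a ha => ha.elim (fun ⟨i, hi⟩ => hi ▸ h.1 i) (fun ⟨i, hi⟩ => hi ▸ h.2 i)⟩
  simp only [toILPRows, List.forall_mem_cons, hsplit]
  simp only [RowHolds, sum_upperRow_mul, sum_lowerRow_mul, Pi.neg_apply, neg_mul, Finset.sum_neg_distrib,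
    sum_single_mul, one_mul, ← forall_and, abs_le]
  have e1 : ∀ i : Fin I.dim, (I.upperRow i).2 = I.eps.num * I.den' := fun i => rfl
  have e2 : ∀ i : Fin I.dim, (I.lowerRow i).2 = I.eps.num * I.den' := fun i => rfl
  simp only [e1, e2]
  constructor
  · rintro ⟨h1, h2, h3⟩
    exact ⟨by omega, by omega, fun i => ⟨by nlinarith [(h3 i).2], by nlinarith [(h3 i).1]⟩⟩
  · rintro ⟨h1, h2, h3⟩
    exact ⟨by omega, by omega, fun i => ⟨by nlinarith [(h3 i).2], by nlinarith [(h3 i).1]⟩⟩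

/-! ### The equivalence with the GSA question -/

/-- The scalar core: for `b, s₂ > 0`, `|q a / b - p| ≤ s₁ / s₂ ↔ |s₂ (a q - b p)| ≤ s₁ b` (in `ℤ`).
[folklore] -/
theorem abs_div_sub_le_div_iff {a p q s₁ : ℤ} {b s₂ : ℕ} (hb : 0 < b) (hs : 0 < s₂) :
    |(q : ℚ) * a / b - p| ≤ (s₁ : ℚ) / s₂ ↔ |(s₂ : ℤ) * (a * q - b * p)| ≤ s₁ * b := by
  have hb' : (0 : ℚ) < b := by exact_mod_cast hb
  have hs' : (0 : ℚ) < s₂ := by exact_mod_cast hs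
  have key : (q : ℚ) * a / b - p = (((s₂ : ℤ) * (a * q - b * p) : ℤ) : ℚ) / ((s₂ : ℚ) * b) := by
    push_cast
    field_simp
  rw [key, abs_div, abs_of_pos (mul_pos hs' hb'), div_le_div_iff₀ (mul_pos hs' hb') hs']
  set Z : ℤ := (s₂ : ℤ) * (a * q - b * p)
  constructor
  · intro h
    have h' : |(Z : ℚ)| ≤ s₁ * b :=
      le_of_mul_le_mul_right (by linarith : |(Z : ℚ)| * s₂ ≤ ((s₁ : ℚ) * b) * s₂) hs'
    exact_mod_cast h'
  · intro h
    have h' : |(Z : ℚ)| ≤ s₁ * b := by exact_mod_cast h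
    calc |(Z : ℚ)| * s₂ ≤ ((s₁ : ℚ) * b) * s₂ := mul_le_mul_of_nonneg_right h' hs'.le
      _ = _ := by ring

/-- **GSA in dimension `d` is the feasibility of `I.toILP`** (Lagarias's reduction to integer
programming in `d + 1` variables): `I.toILP.Feasible ↔ I.Yes`. [cite: Lagarias1985, fixed-dimension theorem (reduction to [LenstraHW1983])] [cite: Schrijver1986, §6.3 p. 168] -/
theorem feasible_toILP_iff (I : SimultaneousApproxInstance) : I.toILP.Feasible ↔ I.Yes := by
  have hden : 0 < I.den' := I.den'_pos
  have heps : I.eps = (I.eps.num : ℚ) / (I.eps.den : ℚ) := (Rat.num_div_den I.eps).symm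
  rw [feasible_toILP_iff_rows, yes_iff]
  constructor
  · rintro ⟨x, hx⟩
    rw [forall_rowHolds_toILP_iff] at hx
    obtain ⟨h1, h2, h3⟩ := hx
    refine ⟨(x 0).toNat, by omega, by omega, fun i => ⟨x i.succ, ?_⟩⟩
    have hq : (((x 0).toNat : ℕ) : ℚ) = ((x 0 : ℤ) : ℚ) := by exact_mod_cast Int.toNat_of_nonneg (by omega)
    rw [show ((x 0).toNat : ℚ) * I.num i / I.den = (x 0).toNat * I.num i / I.den from rfl,
      mul_num_div_den_eq, hq, heps, abs_div_sub_le_div_iff hden I.eps.den_pos]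
    simpa [mul_comm] using h3 i
  · rintro ⟨q, hq1, hqN, h⟩
    choose p hp using h
    refine ⟨Fin.cases (q : ℤ) p, ?_⟩
    rw [forall_rowHolds_toILP_iff]
    refine ⟨by simp; omega, by simp; omega, fun i => ?_⟩
    have hi := hp i
    rw [show (q : ℚ) * I.num i / I.den = q * I.num i / I.den from rfl, mul_num_div_den_eq, heps,
      show ((q : ℕ) : ℚ) = ((q : ℤ) : ℚ) by rfl, abs_div_sub_le_div_iff hden I.eps.den_pos] at hi
    simpa [mul_comm] using hi

/-! ### The polyhedron is bounded -/

/-- `Pi.single j c · x = c x j` over `ℝ`. [folklore] -/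
theorem sum_cast_single_mul {n : ℕ} (j : Fin n) (c : ℤ) (x : Fin n → ℝ) :
    ∑ k, ((Pi.single j c : Fin n → ℤ) k : ℝ) * x k = c * x j := by
  simp [Pi.single_apply]

/-- Every real point of the polyhedron of `I.toILP` lies in the box `1 ≤ x₀ ≤ N`,
`|x_{i+1}| ≤ (|s₁| b + s₂ |aᵢ| N) / (s₂ b)`. [cite: Schrijver1986, §18.4 (bounded case)] -/
theorem abs_le_of_mem_polyhedron_toILP (I : SimultaneousApproxInstance) {x : Fin (I.dim + 1) → ℝ}
    (hx : x ∈ I.toILP.polyhedron) :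
    (1 ≤ x 0 ∧ x 0 ≤ I.bound) ∧ ∀ i : Fin I.dim,
      |x i.succ| ≤ (|(I.eps.num : ℝ)| * I.den' + I.eps.den * |(I.num' i : ℝ)| * I.bound) / (I.eps.den * I.den') := by
  rw [mem_polyhedron_toILP_iff] at hx
  simp only [toILPRows, List.forall_mem_cons, List.mem_append, List.mem_ofFn] at hx
  obtain ⟨h1, h2, h3⟩ := hx
  simp only [Pi.neg_apply, Int.cast_neg, neg_mul, Finset.sum_neg_distrib, sum_cast_single_mul,
    Int.cast_one, one_mul, Int.cast_natCast] at h1 h2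
  have hq1 : 1 ≤ x 0 := by linarith
  have hqN : x 0 ≤ I.bound := h2
  refine ⟨⟨hq1, hqN⟩, fun i => ?_⟩
  have hup := h3 _ (Or.inl ⟨i, rfl⟩)
  have hlo := h3 _ (Or.inr ⟨i, rfl⟩)
  simp only [upperRow, lowerRow, Pi.sub_apply, Pi.neg_apply, Int.cast_sub, Int.cast_neg, sub_mul,
    neg_mul, Finset.sum_sub_distrib, Finset.sum_neg_distrib, sum_cast_single_mul, Int.cast_mul,
    Int.cast_natCast] at hup hlo
  have hs : (0 : ℝ) < I.eps.den := by exact_mod_cast I.eps.den_pos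
  have hb : (0 : ℝ) < I.den' := by exact_mod_cast I.den'_pos
  rw [le_div_iff₀ (mul_pos hs hb)]
  have hprod : |x i.succ| * (I.eps.den * I.den') = |(I.eps.den : ℝ) * I.den' * x i.succ| := by
    rw [abs_mul ((I.eps.den : ℝ) * I.den'), abs_of_pos (mul_pos hs hb), mul_comm]
  rw [hprod, abs_le]
  have hax : |(I.num' i : ℝ) * x 0| ≤ |(I.num' i : ℝ)| * I.bound := by
    rw [abs_mul]
    exact mul_le_mul_of_nonneg_left (abs_le.2 ⟨by linarith, hqN⟩) (abs_nonneg _)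
  have h4 := abs_le.1 hax
  have h5 := le_abs_self (I.eps.num : ℝ)
  have h6 := neg_abs_le (I.eps.num : ℝ)
  constructor <;> nlinarith [mul_nonneg hs.le hb.le]

/-- **The polyhedron of `I.toILP` is bounded** (a polytope): the bounded case of Lenstra's algorithm.
[cite: Schrijver1986, §18.4 (bounded case)] -/
theorem isBounded_toILP (I : SimultaneousApproxInstance) : I.toILP.IsBounded := by
  let C : ℝ := (I.bound : ℝ) + ∑ i : Fin I.dim,
    (|(I.eps.num : ℝ)| * I.den' + I.eps.den * |(I.num' i : ℝ)| * I.bound) / (I.eps.den * I.den')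
  refine (Metric.isBounded_closedBall (x := (0 : Fin (I.dim + 1) → ℝ)) (r := C)).subset fun x hx => ?_
  obtain ⟨⟨h1, h2⟩, h3⟩ := I.abs_le_of_mem_polyhedron_toILP hx
  have hterm : ∀ i : Fin I.dim, 0 ≤
      (|(I.eps.num : ℝ)| * I.den' + I.eps.den * |(I.num' i : ℝ)| * I.bound) / (I.eps.den * I.den') :=
    fun i => (abs_nonneg _).trans (h3 i)
  have hC : (I.bound : ℝ) ≤ C := le_add_of_nonneg_right (Finset.sum_nonneg fun i _ => hterm i)
  rw [Metric.mem_closedBall, dist_zero_right, pi_norm_le_iff_of_nonneg ((Nat.cast_nonneg _).trans hC)]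
  intro j
  rw [Real.norm_eq_abs]
  refine Fin.cases ?_ (fun i => ?_) j
  · rw [abs_of_nonneg (by linarith)]
    exact h2.trans hC
  · exact (h3 i).trans ((Finset.single_le_sum (fun i _ => hterm i) (Finset.mem_univ i)).trans
      (le_add_of_nonneg_left (Nat.cast_nonneg _)))

end SimultaneousApproxInstance

end Literature.NumberTheory.DiophantineApproximation
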